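import Summits.Ventures.PackingBounds.ThreePointCert.K5d14Agg1
import Summits.Ventures.PackingBounds.ThreePointCert.K5d14Agg2
import Summits.Ventures.PackingBounds.ThreePointCert.K5d14Agg3
import Summits.Ventures.PackingBounds.ThreePointCert.K5d14AggM
import Summits.Ventures.PackingBounds.ThreePointCert.CheckSym2Split

/-!
# κ(5) ≤ 44: kernel check, split check of (ii'), step (b): `M − m₂E₂ − M' ≡ 0`

Framing: lottery ticket; floor = certified bounds/negative ranges. Venture `PackingBounds` (cell
`pub-packcert`), three-point SDP family. Integer data / kernel checks of the Bachoc–Vallentin certificate (n = 5,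
s = 1/2, degree d = 14, multiplier set = cell mode sym2; exact certificate `sdp-d5-deg14-sym2-lp-v1.json`, cert2lean_s2.py S = 52)
for the SPLIT check of `(ii')` (`ThreePointCert.CheckSym2Split`: intermediate polynomials `M`, `M'` as data; lp gen 8).
Generated file.
-/

namespace Summit.Ventures.PackingBounds.ThreePointCert.K5d14

open Literature.Geometry.DiscreteGeometry Literature.Geometry.DiscreteGeometry.PolyCert PolyCert.SPoly

set_option maxRecDepth 100000 in
set_option maxHeartbeats 0 in
/-- The certificate passes step (b) of the split check of constraint `(ii')` (Bachoc–Vallentin multiplier set). -/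
theorem cert_IIb : checkII3S2b K5d14.cert K5d14.polys K5d14.polyM K5d14.polyMM = true := by decide +kernel

end Summit.Ventures.PackingBounds.ThreePointCert.K5d14
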